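import Summits.RiemannHypothesis.RiemannHypothesis.Theorems.WeilGroundStateGroundStatesConvergeToXiStubMellinXi
import Literature.NumberTheory.LFunctions.RiemannXiFourier
import Literature.NumberTheory.LFunctions.WeilExplicit
import Mathlib.MeasureTheory.Integral.IntegralEqImproper
import HarnessLib

/-!
# `WeilGroundState.GroundStatesConvergeToXi` — tails of Riemann's kernel `Φ = 2Ψ(2·)`
(crux item stmt-RiemannHypothesis-1527, route route-RiemannHypothesis-WeilGroundState; `--supports`)

RH-free pointwise majorants for `Φ(t) = 2Ψ(2t)`, `Φ'(t) = 4Ψ'(2t)`, `Φ''(t) = 8Ψ''(2t)` by the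
double-exponential envelope `E(t) = exp(|t|/2 − (π/4)e^{2|t|})` (from `LagariasMontague.thetaMajorant`),
and the weighted tail integral `∫_{|t| ≥ A} E(t) e^{|t|/2} dt ≤ (4/π) exp(−(π/4)e^{2A})`.
Used by the super-exponential upper bound for the ground energy `ε(a)` (file `…EnergyUpper`).
-/

noncomputable section

set_option linter.dupNamespace false

open scoped Topology Real
open Filter Set MeasureTheory Complex

namespace Summit.RiemannHypothesis.RiemannHypothesis.Theorems.GroundStatesConvergeToXi

open Literature.NumberTheory.LFunctions

/-- `Φ'`: the derivative of `Φ(t) = 2Ψ(2t)` is `4Ψ'(2t)` (`Ψ' = S_{δ(2X²−3X)}`). [folklore] -/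
theorem phi_hasDerivAt (t : ℝ) :
    HasDerivAt (fun t : ℝ => (2 : ℂ) * LagariasMontague.Psic (2 * t))
      (4 * (LagariasMontague.thetaSeries (LagariasMontague.thetaδ LagariasMontague.psiPoly) (2 * t) : ℂ)) t := by
  have h : HasDerivAt (fun t : ℝ => (2 : ℂ) * LagariasMontague.Psic (2 * t))
      (2 * ((2 : ℝ) • (LagariasMontague.thetaSeries
        (LagariasMontague.thetaδ LagariasMontague.psiPoly) (2 * t) : ℂ))) t :=
    ((LagariasMontague.hasDerivAt_Psic (2 * t)).scomp t (hasDerivAt_const_mul (2 : ℝ))).const_mul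
      (2 : ℂ)
  refine h.congr_deriv ?_
  rw [Complex.real_smul]
  push_cast
  ring

/-- `Φ''`: the derivative of `4Ψ'(2t)` is `8Ψ''(2t)` (`Ψ'' = S_{δδ(2X²−3X)}`). [folklore] -/
theorem dphi_hasDerivAt (t : ℝ) :
    HasDerivAt (fun t : ℝ => (4 : ℂ) *
        (LagariasMontague.thetaSeries (LagariasMontague.thetaδ LagariasMontague.psiPoly) (2 * t) : ℂ))
      (8 * (LagariasMontague.thetaSeries
        (LagariasMontague.thetaδ (LagariasMontague.thetaδ LagariasMontague.psiPoly)) (2 * t) : ℂ)) t := by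
  have h : HasDerivAt (fun t : ℝ => (4 : ℂ) *
        (LagariasMontague.thetaSeries (LagariasMontague.thetaδ LagariasMontague.psiPoly) (2 * t) : ℂ))
      (4 * ((2 : ℝ) • (LagariasMontague.thetaSeries
        (LagariasMontague.thetaδ (LagariasMontague.thetaδ LagariasMontague.psiPoly)) (2 * t) : ℂ))) t :=
    (((LagariasMontague.hasDerivAt_thetaSeries (LagariasMontague.thetaδ LagariasMontague.psiPoly)
      (2 * t)).ofReal_comp).scomp t (hasDerivAt_const_mul (2 : ℝ))).const_mul (4 : ℂ)
  refine h.congr_deriv ?_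
  rw [Complex.real_smul]
  push_cast
  ring

/-- The envelope is the theta majorant at `2|t|`: `M(2|t|) = exp(|t|/2 − (π/4)e^{2|t|})`.
[folklore] -/
theorem thetaMajorant_two_mul_abs (t : ℝ) :
    LagariasMontague.thetaMajorant (2 * |t|) = Real.exp (|t| / 2 - π / 4 * Real.exp (2 * |t|)) := by
  rw [LagariasMontague.thetaMajorant]
  congr 1
  ring

/-- Majorant of `S_p(2t)` on all of `ℝ` for a theta series with `|S_p(−u)| = |S_p(u)|`:
`|S_p(2t)| ≤ C exp(|t|/2 − (π/4)e^{2|t|})`. [folklore] -/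
theorem exists_abs_thetaSeries_two_mul_le (p : Polynomial ℝ)
    (hpar : ∀ u : ℝ, |LagariasMontague.thetaSeries p (-u)| = |LagariasMontague.thetaSeries p u|) :
    ∃ C : ℝ, 0 ≤ C ∧ ∀ t : ℝ, |LagariasMontague.thetaSeries p (2 * t)| ≤
      C * Real.exp (|t| / 2 - π / 4 * Real.exp (2 * |t|)) := by
  obtain ⟨C, hC, hb⟩ := LagariasMontague.exists_abs_thetaSeries_le p 0
  refine ⟨C, hC, fun t => ?_⟩
  have key : |LagariasMontague.thetaSeries p (2 * t)| =
      |LagariasMontague.thetaSeries p (2 * |t|)| := by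
    rcases le_or_gt 0 t with h | h
    · rw [abs_of_nonneg h]
    · rw [abs_of_neg h, mul_neg, hpar]
  rw [key, ← thetaMajorant_two_mul_abs]
  exact hb _ (by rw [neg_zero]; positivity)

/-- Double-exponential majorant of `Φ`: `‖Φ(t)‖ ≤ K exp(|t|/2 − (π/4)e^{2|t|})`. [folklore] -/
theorem exists_norm_phi_le :
    ∃ K : ℝ, 0 ≤ K ∧ ∀ t : ℝ, ‖(2 : ℂ) * LagariasMontague.Psic (2 * t)‖ ≤
      K * Real.exp (|t| / 2 - π / 4 * Real.exp (2 * |t|)) := by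
  obtain ⟨C, hC, hb⟩ := exists_abs_thetaSeries_two_mul_le LagariasMontague.psiPoly fun u => by
    show |LagariasMontague.Psi (-u)| = |LagariasMontague.Psi u|
    rw [LagariasMontague.Psi_neg]
  refine ⟨2 * C, by positivity, fun t => ?_⟩
  rw [norm_phi, mul_assoc]
  exact mul_le_mul_of_nonneg_left (hb t) two_pos.le

/-- Double-exponential majorant of `Φ'`. [folklore] -/
theorem exists_norm_dphi_le :
    ∃ K : ℝ, 0 ≤ K ∧ ∀ t : ℝ, ‖(4 : ℂ) *
        (LagariasMontague.thetaSeries (LagariasMontague.thetaδ LagariasMontague.psiPoly) (2 * t) : ℂ)‖ ≤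
      K * Real.exp (|t| / 2 - π / 4 * Real.exp (2 * |t|)) := by
  obtain ⟨C, hC, hb⟩ := exists_abs_thetaSeries_two_mul_le
    (LagariasMontague.thetaδ LagariasMontague.psiPoly) fun u => by
      rw [LagariasMontague.thetaSeries_δ_psiPoly_neg, abs_neg]
  refine ⟨4 * C, by positivity, fun t => ?_⟩
  rw [norm_mul, Complex.norm_real, Real.norm_eq_abs, Complex.norm_ofNat, mul_assoc]
  exact mul_le_mul_of_nonneg_left (hb t) (by norm_num)

/-- Double-exponential majorant of `Φ''`. [folklore] -/
theorem exists_norm_ddphi_le :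
    ∃ K : ℝ, 0 ≤ K ∧ ∀ t : ℝ, ‖(8 : ℂ) * (LagariasMontague.thetaSeries
        (LagariasMontague.thetaδ (LagariasMontague.thetaδ LagariasMontague.psiPoly)) (2 * t) : ℂ)‖ ≤
      K * Real.exp (|t| / 2 - π / 4 * Real.exp (2 * |t|)) := by
  obtain ⟨C, hC, hb⟩ := exists_abs_thetaSeries_two_mul_le
    (LagariasMontague.thetaδ (LagariasMontague.thetaδ LagariasMontague.psiPoly)) fun u => by
      rw [LagariasMontague.thetaSeries_δδ_psiPoly_neg]
  refine ⟨8 * C, by positivity, fun t => ?_⟩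
  rw [norm_mul, Complex.norm_real, Real.norm_eq_abs, Complex.norm_ofNat, mul_assoc]
  exact mul_le_mul_of_nonneg_left (hb t) (by norm_num)

/-- The one-sided weighted envelope `u ↦ exp(u − (π/4)e^{2u})` is integrable on `(0, ∞)`
(it is dominated by `e^{−u/2}` there, since `e^{2u} ≥ 1 + 2u` and `π ≥ 3`). [folklore] -/
theorem integrableOn_envelope_Ioi :
    IntegrableOn (fun u : ℝ => Real.exp (u - π / 4 * Real.exp (2 * u))) (Ioi 0) := by
  refine (exp_neg_integrableOn_Ioi 0 (by norm_num : (0 : ℝ) < 1 / 2)).mono'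
    (by fun_prop : Continuous fun u : ℝ => Real.exp (u - π / 4 * Real.exp (2 * u))).aestronglyMeasurable
    (ae_restrict_of_forall_mem measurableSet_Ioi fun u hu => ?_)
  rw [Real.norm_eq_abs, abs_of_pos (Real.exp_pos _), Real.exp_le_exp]
  have hE := Real.add_one_le_exp (2 * u)
  have hπE : 3 / 4 * Real.exp (2 * u) ≤ π / 4 * Real.exp (2 * u) :=
    mul_le_mul_of_nonneg_right (by linarith [Real.pi_gt_three]) (Real.exp_pos _).le
  have hu' : 0 < u := hu
  linarith

/-- The weighted envelope `t ↦ exp(|t| − (π/4)e^{2|t|})` is integrable on `ℝ`. [folklore] -/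
theorem integrable_envelope :
    Integrable fun t : ℝ => Real.exp (|t| - π / 4 * Real.exp (2 * |t|)) :=
  LagariasMontague.integrable_comp_abs (F := fun u : ℝ => Real.exp (u - π / 4 * Real.exp (2 * u)))
    (by fun_prop) integrableOn_envelope_Ioi

/-- FTC on `(A, ∞)`: `t ↦ e^{2t} exp(−(π/4)e^{2t}) = d/dt [−(2/π) exp(−(π/4)e^{2t})]` is integrable on
`(A, ∞)` with integral `(2/π) exp(−(π/4)e^{2A})`. [folklore] -/
theorem integral_Ioi_exp_two_mul_mul_exp (A : ℝ) :
    IntegrableOn (fun t : ℝ => Real.exp (2 * t) * Real.exp (-(π / 4 * Real.exp (2 * t)))) (Ioi A) ∧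
    ∫ t in Ioi A, Real.exp (2 * t) * Real.exp (-(π / 4 * Real.exp (2 * t))) =
      2 / π * Real.exp (-(π / 4 * Real.exp (2 * A))) := by
  have hderiv : ∀ t : ℝ, HasDerivAt (fun t : ℝ => -(2 / π) * Real.exp (-(π / 4 * Real.exp (2 * t))))
      (Real.exp (2 * t) * Real.exp (-(π / 4 * Real.exp (2 * t)))) t := by
    intro t
    have h1 : HasDerivAt (fun t : ℝ => Real.exp (2 * t)) (Real.exp (2 * t) * 2) t :=
      (hasDerivAt_const_mul (2 : ℝ)).exp
    have h2 := ((h1.const_mul (π / 4)).fun_neg.exp).const_mul (-(2 / π))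
    refine h2.congr_deriv ?_
    field_simp
    ring
  have hlim : Tendsto (fun t : ℝ => -(2 / π) * Real.exp (-(π / 4 * Real.exp (2 * t)))) atTop (𝓝 0) := by
    have h1 : Tendsto (fun t : ℝ => π / 4 * Real.exp (2 * t)) atTop atTop :=
      (Real.tendsto_exp_atTop.comp (tendsto_id.const_mul_atTop two_pos)).const_mul_atTop
        (by positivity)
    have h2 : Tendsto (fun t : ℝ => Real.exp (-(π / 4 * Real.exp (2 * t)))) atTop (𝓝 0) :=
      Real.tendsto_exp_atBot.comp (tendsto_neg_atTop_atBot.comp h1)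
    have h3 := h2.const_mul (-(2 / π))
    rwa [mul_zero] at h3
  have hint : IntegrableOn (fun t : ℝ => Real.exp (2 * t) * Real.exp (-(π / 4 * Real.exp (2 * t))))
      (Ioi A) :=
    integrableOn_Ioi_deriv_of_nonneg (hderiv A).continuousAt.continuousWithinAt
      (fun t _ => hderiv t) (fun t _ => mul_nonneg (Real.exp_pos _).le (Real.exp_pos _).le) hlim
  refine ⟨hint, ?_⟩
  rw [integral_Ioi_of_hasDerivAt_of_tendsto (hderiv A).continuousAt.continuousWithinAt
    (fun t _ => hderiv t) hint hlim]
  ring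

/-- One-sided weighted tail: for `A ≥ 0`, `∫_{(A,∞)} exp(u − (π/4)e^{2u}) du ≤ (2/π) exp(−(π/4)e^{2A})`
(as `u ≤ 2u` on `u ≥ 0`). [folklore] -/
theorem setIntegral_Ioi_envelope_le {A : ℝ} (hA : 0 ≤ A) :
    ∫ u in Ioi A, Real.exp (u - π / 4 * Real.exp (2 * u)) ≤
      2 / π * Real.exp (-(π / 4 * Real.exp (2 * A))) := by
  obtain ⟨hint, hval⟩ := integral_Ioi_exp_two_mul_mul_exp A
  rw [← hval]
  refine setIntegral_mono_on (integrableOn_envelope_Ioi.mono_set (Ioi_subset_Ioi hA)) hint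
    measurableSet_Ioi fun u hu => ?_
  rw [← Real.exp_add, Real.exp_le_exp]
  have : 0 ≤ u := hA.trans (le_of_lt hu)
  linarith

/-- **Weighted tail of the envelope**: for `A ≥ 0`,
`∫_{|t| ≥ A} exp(|t| − (π/4)e^{2|t|}) dt ≤ (4/π) exp(−(π/4)e^{2A})`
(on `t ≥ 0`, `e^{t} ≤ e^{2t}` and `e^{2t}exp(−(π/4)e^{2t}) = −(2/π) d/dt exp(−(π/4)e^{2t})`). [folklore] -/
theorem setIntegral_envelope_le {A : ℝ} (hA : 0 ≤ A) :
    ∫ t in {t : ℝ | A ≤ |t|}, Real.exp (|t| - π / 4 * Real.exp (2 * |t|)) ≤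
      4 / π * Real.exp (-(π / 4 * Real.exp (2 * A))) := by
  have hS : MeasurableSet {t : ℝ | A ≤ |t|} :=
    (isClosed_le continuous_const continuous_abs).measurableSet
  have h1 : ∫ t in {t : ℝ | A ≤ |t|}, Real.exp (|t| - π / 4 * Real.exp (2 * |t|)) =
      2 * ∫ u in Ioi (0 : ℝ), (Ici A).indicator
        (fun u : ℝ => Real.exp (u - π / 4 * Real.exp (2 * u))) u := by
    rw [← integral_indicator hS, ← integral_comp_abs]
    refine integral_congr_ae (ae_of_all _ fun t => ?_)
    dsimp only
    by_cases ht : A ≤ |t|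
    · rw [indicator_of_mem (show t ∈ {t : ℝ | A ≤ |t|} from ht),
        indicator_of_mem (show |t| ∈ Ici A from ht)]
    · rw [indicator_of_notMem (show t ∉ {t : ℝ | A ≤ |t|} from ht),
        indicator_of_notMem (show |t| ∉ Ici A from ht)]
  have h2 : ∫ u in Ioi (0 : ℝ), (Ici A).indicator
        (fun u : ℝ => Real.exp (u - π / 4 * Real.exp (2 * u))) u ≤
      ∫ u in Ioi A, Real.exp (u - π / 4 * Real.exp (2 * u)) := by
    rw [setIntegral_indicator measurableSet_Ici, ← integral_Ici_eq_integral_Ioi]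
    have hIci : IntegrableOn (fun u : ℝ => Real.exp (u - π / 4 * Real.exp (2 * u))) (Ici 0) :=
      (integrableOn_Ici_iff_integrableOn_Ioi).mpr integrableOn_envelope_Ioi
    exact setIntegral_mono_set (hIci.mono_set (Ici_subset_Ici.mpr hA))
      (ae_of_all _ fun u => (Real.exp_pos _).le) (LE.le.eventuallyLE inter_subset_right)
  rw [h1]
  calc 2 * ∫ u in Ioi (0 : ℝ), (Ici A).indicator
        (fun u : ℝ => Real.exp (u - π / 4 * Real.exp (2 * u))) u
      ≤ 2 * ∫ u in Ioi A, Real.exp (u - π / 4 * Real.exp (2 * u)) :=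
        mul_le_mul_of_nonneg_left h2 two_pos.le
    _ ≤ 2 * (2 / π * Real.exp (-(π / 4 * Real.exp (2 * A)))) :=
        mul_le_mul_of_nonneg_left (setIntegral_Ioi_envelope_le hA) two_pos.le
    _ = 4 / π * Real.exp (-(π / 4 * Real.exp (2 * A))) := by ring

/-- **Weighted `L¹` tail bound**: if `h` is continuous, vanishes on `(-A, A)` (`A ≥ 0`) and is
dominated by `K · exp(|t|/2 − (π/4)e^{2|t|})`, then `t ↦ ‖h t‖ e^{|t|/2}` is integrable and
`∫ ‖h‖ e^{|t|/2} ≤ K (4/π) exp(−(π/4)e^{2A})`. [folklore] -/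
theorem integral_norm_mul_exp_half_le_of_envelope {h : ℝ → ℂ} (hc : Continuous h) {K A : ℝ}
    (hK : 0 ≤ K) (hA : 0 ≤ A)
    (hdom : ∀ t : ℝ, ‖h t‖ ≤ K * Real.exp (|t| / 2 - π / 4 * Real.exp (2 * |t|)))
    (hvan : ∀ t : ℝ, |t| < A → h t = 0) :
    Integrable (fun t : ℝ => ‖h t‖ * Real.exp (|t| / 2)) ∧
      ∫ t : ℝ, ‖h t‖ * Real.exp (|t| / 2) ≤ K * (4 / π * Real.exp (-(π / 4 * Real.exp (2 * A)))) := by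
  have hS : MeasurableSet {t : ℝ | A ≤ |t|} :=
    (isClosed_le continuous_const continuous_abs).measurableSet
  have hpt : ∀ t : ℝ, ‖h t‖ * Real.exp (|t| / 2) ≤
      K * Real.exp (|t| - π / 4 * Real.exp (2 * |t|)) := fun t => by
    calc ‖h t‖ * Real.exp (|t| / 2)
        ≤ K * Real.exp (|t| / 2 - π / 4 * Real.exp (2 * |t|)) * Real.exp (|t| / 2) :=
          mul_le_mul_of_nonneg_right (hdom t) (Real.exp_pos _).le
      _ = K * Real.exp (|t| - π / 4 * Real.exp (2 * |t|)) := by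
          rw [mul_assoc, ← Real.exp_add]
          congr 2
          ring
  have hmeas : AEStronglyMeasurable (fun t : ℝ => ‖h t‖ * Real.exp (|t| / 2)) volume :=
    (hc.norm.mul (by fun_prop)).aestronglyMeasurable
  have hint : Integrable (fun t : ℝ => ‖h t‖ * Real.exp (|t| / 2)) :=
    (integrable_envelope.const_mul K).mono' hmeas (ae_of_all _ fun t => by
      rw [Real.norm_of_nonneg (mul_nonneg (norm_nonneg _) (Real.exp_pos _).le)]
      exact hpt t)
  refine ⟨hint, ?_⟩
  have hpt' : ∀ t : ℝ, ‖h t‖ * Real.exp (|t| / 2) ≤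
      K * {t : ℝ | A ≤ |t|}.indicator (fun t => Real.exp (|t| - π / 4 * Real.exp (2 * |t|))) t := by
    intro t
    by_cases ht : A ≤ |t|
    · rw [indicator_of_mem (show t ∈ {t : ℝ | A ≤ |t|} from ht)]
      exact hpt t
    · rw [hvan t (not_le.mp ht), norm_zero, zero_mul]
      exact mul_nonneg hK (indicator_nonneg (fun _ _ => (Real.exp_pos _).le) _)
  calc ∫ t : ℝ, ‖h t‖ * Real.exp (|t| / 2)
      ≤ ∫ t : ℝ, K * {t : ℝ | A ≤ |t|}.indicator
          (fun t => Real.exp (|t| - π / 4 * Real.exp (2 * |t|))) t :=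
        integral_mono_of_nonneg (ae_of_all _ fun t => mul_nonneg (norm_nonneg _) (Real.exp_pos _).le)
          ((integrable_envelope.indicator hS).const_mul K) (ae_of_all _ hpt')
    _ = K * ∫ t in {t : ℝ | A ≤ |t|}, Real.exp (|t| - π / 4 * Real.exp (2 * |t|)) := by
        rw [integral_const_mul, integral_indicator hS]
    _ ≤ K * (4 / π * Real.exp (-(π / 4 * Real.exp (2 * A)))) :=
        mul_le_mul_of_nonneg_left (setIntegral_envelope_le hA) hK

/-- Integrability of `h · e^{c t}` in the closed strip `|Re c| ≤ 1/2` for an envelope-dominated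
continuous `h`. [folklore] -/
theorem integrable_mul_cexp_of_envelope {h : ℝ → ℂ} (hc : Continuous h) {K : ℝ}
    (hdom : ∀ t : ℝ, ‖h t‖ ≤ K * Real.exp (|t| / 2 - π / 4 * Real.exp (2 * |t|)))
    {c : ℂ} (hcre : |c.re| ≤ 1 / 2) :
    Integrable fun t : ℝ => h t * cexp (c * t) := by
  refine (integrable_envelope.const_mul K).mono'
    (hc.mul (by fun_prop : Continuous fun t : ℝ => cexp (c * t))).aestronglyMeasurable
    (ae_of_all _ fun t => ?_)
  rw [norm_mul, Complex.norm_exp]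
  have hre : (c * (t : ℂ)).re = c.re * t := by
    simp only [Complex.mul_re, Complex.ofReal_re, Complex.ofReal_im, mul_zero, sub_zero]
  rw [hre]
  have h1 : c.re * t ≤ |t| / 2 := by
    calc c.re * t ≤ |c.re * t| := le_abs_self _
      _ = |c.re| * |t| := abs_mul _ _
      _ ≤ 1 / 2 * |t| := mul_le_mul_of_nonneg_right hcre (abs_nonneg _)
      _ = |t| / 2 := by ring
  calc ‖h t‖ * Real.exp (c.re * t) ≤ ‖h t‖ * Real.exp (|t| / 2) :=
        mul_le_mul_of_nonneg_left (Real.exp_le_exp.mpr h1) (norm_nonneg _)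
    _ ≤ K * Real.exp (|t| / 2 - π / 4 * Real.exp (2 * |t|)) * Real.exp (|t| / 2) :=
        mul_le_mul_of_nonneg_right (hdom t) (Real.exp_pos _).le
    _ = K * Real.exp (|t| - π / 4 * Real.exp (2 * |t|)) := by
        rw [mul_assoc, ← Real.exp_add]
        congr 2
        ring

end Summit.RiemannHypothesis.RiemannHypothesis.Theorems.GroundStatesConvergeToXi

end
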